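import Mathlib

/-!
# Trivial decomposition groups: at local degree one the Galois group injects into the primes

Blind cell `pub-hodge-repro2`, seat p7 (gen 9), Tier-5 kernel support for N5 / §G S0
(route/T5-CHECK-G-p7.md §12.2 row P1.5 and §16.2: the prose-only last line «the places induced by
Σ and Σc are then disjoint (the map embeddings → places is injective when every local degree is 1)»
— the clause the coverage map of §16.2 left as «one line, prose», with the remark that Mathlib
has no vocabulary for «the place induced by an embedding into ℂ_p»).

The vocabulary used here is Mathlib's Galois-group one: for a Galois group `G` of `S/R`
(`IsGaloisGroup G R S`, e.g. `Gal(L/K)` acting on the integral closure `S` of `R` in `L` through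
`galRestrict`), `G` acts transitively on the primes `P` of `S` over a prime `p` of `R`, the
stabiliser of `P` is the decomposition group, and Mathlib's `Ideal.card_stabilizer_eq` gives
`|D_P| = e · f`.  Hence:

* `stabilizer_eq_bot_of_degree_one`: `e · f = 1 ⇒ D_P = 1`;
* `smul_injective_of_degree_one`: `σ ↦ σ • P` is INJECTIVE on `G`;
* `disjoint_image_of_degree_one`: disjoint subsets `Σ, Σ'` of `G` induce DISJOINT sets of primes
  — P1.5's «Σ_p ∩ Σ_pc = ∅» once the elements of a CM type are read as Galois-group elements
  (`Σ ∩ Σc = ∅` is the definition of a CM type);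
* `bijective_smul_primesOver` / `card_eq_ncard_primesOver`: `σ ↦ σ • P` is a BIJECTION
  `G ≃ {primes over p}` (transitivity + injectivity), `|G| = #{primes over p}`;
* the `Gal(L/K)` / `galRestrict` form `injective_map_galRestrict_of_degree_one`.

What stays prose: that the `p`-adic place «induced by the embedding `ι_p ∘ σ`» is the prime
`σ⁻¹ • P₀` for the prime `P₀` induced by `ι_p` — the identification of embeddings of a Galois
field with its Galois group, and of `ι_p`-induced places with primes (the reading of print).
README §8(d): uses an L-value-free non-vanishing device: NO.
-/

namespace Summit.Ventures.HodgeRepro2.T5DecompositionTrivial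

open Ideal MulAction
open scoped Pointwise

section Abstract

variable {R S : Type*} [CommRing R] [CommRing S] [Algebra R S]
  (G : Type*) [Group G] [Finite G] [MulSemiringAction G S] [IsGaloisGroup G R S]
  [IsDomain R] [IsDomain S] [Module.Finite R S] [Module.Flat R S]
  (p : Ideal R) [p.IsPrime] (P : Ideal S) [P.IsPrime] [P.LiesOver p]
  [PerfectField p.ResidueField]

/-- `e · f = 1` ⇒ the decomposition group (stabiliser) of `P` is trivial
(Mathlib's `Ideal.card_stabilizer_eq`: `|D_P| = e · f`). -/
theorem stabilizer_eq_bot_of_degree_one (h : p.ramificationIdxIn S * p.inertiaDegIn S = 1) :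
    stabilizer G P = ⊥ :=
  Subgroup.card_eq_one.mp (by rw [Ideal.card_stabilizer_eq (G := G) p P, h])

omit [IsDomain R] [IsDomain S] [Module.Finite R S] [Module.Flat R S] [PerfectField p.ResidueField]
  [IsGaloisGroup G R S] [Finite G] [p.IsPrime] [P.IsPrime] [P.LiesOver p] in
/-- A trivial stabiliser makes the orbit map `σ ↦ σ • P` injective. -/
theorem smul_injective_of_stabilizer_eq_bot (h : stabilizer G P = ⊥) :
    Function.Injective (fun σ : G => σ • P) := by
  intro σ τ hστ
  have hστ' : σ • P = τ • P := hστ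
  have hmem : τ⁻¹ * σ ∈ stabilizer G P := by
    rw [mem_stabilizer_iff, mul_smul, hστ', inv_smul_smul]
  rw [h, Subgroup.mem_bot] at hmem
  exact (inv_mul_eq_one.mp hmem).symm

/-- `e · f = 1` ⇒ `σ ↦ σ • P` is injective on the Galois group. -/
theorem smul_injective_of_degree_one (h : p.ramificationIdxIn S * p.inertiaDegIn S = 1) :
    Function.Injective (fun σ : G => σ • P) :=
  smul_injective_of_stabilizer_eq_bot G P (stabilizer_eq_bot_of_degree_one G p P h)

/-- P1.5's last line: at local degree one, DISJOINT sets of Galois-group elements induce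
DISJOINT sets of primes (for a CM type `Σ`: `Σ ∩ Σc = ∅` ⇒ `Σ_p ∩ Σ_pc = ∅`). -/
theorem disjoint_image_of_degree_one (h : p.ramificationIdxIn S * p.inertiaDegIn S = 1)
    {T T' : Set G} (hd : Disjoint T T') :
    Disjoint ((fun σ : G => σ • P) '' T) ((fun σ : G => σ • P) '' T') :=
  (Set.disjoint_image_iff (smul_injective_of_degree_one G p P h)).mpr hd

/-- The orbit map into `primesOver p S` is injective at local degree one. -/
theorem smul_primesOver_injective_of_degree_one
    (h : p.ramificationIdxIn S * p.inertiaDegIn S = 1) :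
    Function.Injective (fun σ : G => σ • primesOver.mk p P) := by
  intro σ τ hστ
  apply smul_injective_of_degree_one G p P h
  have := congrArg Subtype.val hστ
  simpa using this

omit [IsDomain R] [IsDomain S] [Module.Finite R S] [Module.Flat R S] [p.IsPrime]
  [PerfectField p.ResidueField] in
/-- The orbit map `G → primesOver p S` is surjective (Mathlib's transitivity
`isPretransitive_of_isGaloisGroup`). -/
theorem smul_primesOver_surjective :
    Function.Surjective (fun σ : G => σ • primesOver.mk p P) :=
  MulAction.surjective_smul G (primesOver.mk p P)

/-- At local degree one, `σ ↦ σ • P` is a BIJECTION from the Galois group onto the set of primes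
over `p`. -/
theorem bijective_smul_primesOver (h : p.ramificationIdxIn S * p.inertiaDegIn S = 1) :
    Function.Bijective (fun σ : G => σ • primesOver.mk p P) :=
  ⟨smul_primesOver_injective_of_degree_one G p P h, smul_primesOver_surjective G p P⟩

include P in
/-- `|G| = #{primes over p}` at local degree one. -/
theorem card_eq_ncard_primesOver (h : p.ramificationIdxIn S * p.inertiaDegIn S = 1) :
    Nat.card G = (p.primesOver S).ncard := by
  rw [← Nat.card_coe_set_eq]
  exact Nat.card_congr (Equiv.ofBijective _ (bijective_smul_primesOver G p P h))

omit [IsDomain R] [IsDomain S] [Module.Finite R S] [Module.Flat R S] [p.IsPrime]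
  [PerfectField p.ResidueField] in
include G in
/-- The degree-one hypothesis in terms of `P` itself (`e(P) = 1`, `f(P) = 1`), via Mathlib's
`ramificationIdxIn_eq_ramificationIdx` / `inertiaDegIn_eq_inertiaDeg` (all primes over `p` share
`e` and `f` in a Galois extension). -/
theorem degree_one_of_ramificationIdx_eq_one_of_inertiaDeg_eq_one
    (he : P.ramificationIdx R = 1) (hf : P.inertiaDeg R = 1) :
    p.ramificationIdxIn S * p.inertiaDegIn S = 1 := by
  rw [Ideal.ramificationIdxIn_eq_ramificationIdx p P G, Ideal.inertiaDegIn_eq_inertiaDeg p P G,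
    he, hf]

end Abstract

section Galois

variable (R K L S : Type*) [CommRing R] [CommRing S] [Algebra R S] [Field K] [Field L]
  [Algebra R K] [IsFractionRing R K] [Algebra S L] [Algebra K L] [Algebra R L]
  [IsScalarTower R S L] [IsScalarTower R K L] [IsIntegralClosure S R L] [FiniteDimensional K L]
  [IsDedekindDomain R] [IsGalois K L] [Module.Flat R S]
  (p : Ideal R) [p.IsPrime] (P : Ideal S) [P.IsPrime] [P.LiesOver p]
  [PerfectField p.ResidueField]

/-- The `Gal(L/K)` form: with `S` the integral closure of the Dedekind domain `R` in the Galois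
extension `L/K`, at local degree one the map `σ ↦ σ(P) = map (galRestrict R K L S σ) P` is
injective on `Gal(L/K)` — «distinct embeddings induce distinct places». -/
theorem injective_map_galRestrict_of_degree_one
    (h : p.ramificationIdxIn S * p.inertiaDegIn S = 1) :
    Function.Injective (fun σ : Gal(L/K) => Ideal.map (galRestrict R K L S σ) P) := by
  have : IsDomain S :=
    (IsIntegralClosure.equiv R S L (integralClosure R L)).toMulEquiv.isDomain (integralClosure R L)
  have : Module.Finite R S := IsIntegralClosure.finite R K L S
  have : IsFractionRing S L := IsIntegralClosure.isFractionRing_of_finite_extension R K L S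
  let : MulSemiringAction Gal(L/K) S := IsIntegralClosure.MulSemiringAction R K L S
  have : IsGaloisGroup Gal(L/K) R S := IsGaloisGroup.of_isFractionRing _ _ _ K L
  exact smul_injective_of_degree_one Gal(L/K) p P h

end Galois

end Summit.Ventures.HodgeRepro2.T5DecompositionTrivial
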